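import Literature.NumberTheory.EllipticCurves.HeegnerPointsKolyvaginCebotarevProofs
import Literature.NumberTheory.GaloisRepresentations.AbsGaloisInvolutions
import Literature.NumberTheory.GaloisRepresentations.CyclotomicCharacterReductionProofs
import Mathlib.RingTheory.RootsOfUnity.AlgebraicallyClosed
import HarnessLib

/-!
# Howard 2004, Lemma 1.6.2 — the Čebotarev step, module-free: inert primes of an imaginary quadratic
# field whose Frobenius is `(ug)^τ (ug)` for an ABSTRACT involutive lift `τ` of complex conjugation

Topic `NumberTheory/GaloisCohomology/Howard2004` (input of Howard's Lemma 1.6.4, the residual Galois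
input of the print leaf G87 `Howard2004.thm161_dvrKolyvaginBound` = Thm. 1.6.1; cell
`pub/bsd-print-x9`, seat `bsd-line-x10b-p1-w6` g8).  THEOREMS ONLY: no definition, no named fact,
no instance, no notation, no `sorry`.

Printed source.  B. Howard, *The Heegner point Kolyvagin system*, Compositio Math. **140** (2004)
= arXiv:1202.6340, Lemma 1.6.2 (arXiv Lemma 2.6.2, p. 11 L30–58), proof: «… we may choose some
`σ ∈ G` such that `η = (τσ)²`.  By the Cebotarev theorem, there are infinitely many primes `ℓ` of
`ℚ` whose Frobenius class in `Gal(E/ℚ)` is equal to `τσ`, and at which the localizations of `c^±`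
are unramified.  For such an `ℓ`, the image of `c^±` under
`H¹(K,T̄) → H¹(K_ℓ,T̄) → H¹_unr(K_ℓ,T̄) ≅ T̄` (the final isomorphism being evaluation at the
Frobenius of the prime of `K` above `ℓ`) is equal to `c^±(η) ≠ 0`.»  The same step is McCallum
1991, Prop. 3.1 (proof): «By the Čebotarev density theorem, there are infinitely many primes `l`
such that `Frob(l)` contains `τρ` … `l` has residue class degree `2` … `Frob(λ') = (τρ)² = ρ^τ·ρ`»,
which the tree proves for the classes `H¹(K, E[p^M])` of an elliptic curve and for `τ` a CHOSEN
complex conjugation `c₀ ∈ Γ_ℚ` transported to `K̄`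
(`EllipticCurves.exists_kolyvaginPrime_gt_of_galoisElement`, Steps C–F).

What is here (module-free, and for the ABSTRACT involutive lift `τ` of the `ConjugationDatum` of
`Howard2004/SelmerTriples.lean` — any ring involution `τ` of `K̄` lifting the non-trivial
automorphism `σ` of the imaginary quadratic field `K`):

* §1 `exists_absGaloisTransport_eq`, `isComplexConjugation_of_absGaloisTransport_eq` — `τ` IS the
  transport of an element `c₀ ∈ Γ_ℚ`, which is a complex conjugation for `ℚ ⊂ ℝ` (Artin–Schreier,
  tree `exists_isComplexConjugation_of_sq_eq_one`); `sq_absGaloisRestrict_eq_of_absGaloisTransport_eq`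
  — «`(τσ)² = σ^τ σ`» in `Γ_ℚ`;
* §2 `smul_eq_inv_of_isComplexConjugation_of_pow_eq_one`, `apply_eq_inv_of_isLiftOfAut_of_pow_eq_one`
  — a complex conjugation, hence every involutive lift `τ`, INVERTS the roots of unity of `K̄`
  (this is what makes Howard's primes satisfy `p^{2k-1} ∣ ℓ + 1`, i.e. lie in `𝓛_{2k-1}(T)`);
* §3 `smul_eq_pow_of_isArithFrobAt_rat` — an arithmetic Frobenius of `Γ_ℚ` above `ℓ` raises the
  roots of unity of order prime to `ℓ` to the `ℓ`-th power (Mathlib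
  `AlgHom.IsArithFrobAt.apply_of_pow_eq_one`, unwrapped from `\bar ℤ`);
* §4 **`exists_inert_prime_isArithFrobAt_conjGal_mul`** — THE STEP: for `U ≤ Γ_K` open (Howard:
  `Γ_E`), `g ∈ Γ_K` (Howard: a lift of `σ ∈ Gal(E/L)`), a finite set `B` of rational primes and a
  finite set `S` of places of `K` to avoid, there are a prime `ℓ ∉ B` INERT in `K`, its place
  `w ∉ S`, `u ∈ U`, and a prime `𝔔 ∣ w` of `\bar ℤ_K` at which `(ug)^τ (ug)` is an arithmetic
  Frobenius; moreover `τ((ug)ζ) = ζ^ℓ` for every root of unity `ζ ∈ K̄` of order prime to `ℓ`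
  («`Frob_ℓ = τσ` on `μ_m`»), whence `m ∣ ℓ + 1` whenever `ug` fixes `μ_m` (§2).

HONEST FRAMING.  This is NOT Lemma 1.6.2 (the `τ`-eigenspace argument from H.1/H.5(a) producing
`η` with `c^±(η) ≠ 0`, and the local criterion «`loc_λ c = 0 ⟺ c(Frob_λ) = 0`» for an abstract
discrete Galois module, remain), not Lemma 1.6.4, not Thm. 1.6.1; `thm161_dvrKolyvaginBound` is
NOT proved; no summit statement is proved; the Birch–Swinnerton-Dyer conjecture is not proved by
any of this.  Input named fact: the Čebotarev density theorem `Automorphic.chebotarev_artinRep`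
(a hypothesis; PROVED in the tree as `Automorphic.chebotarev_artinRep_holds`).

References: [Howard2004HeegnerKolyvagin] Lemma 1.6.2 (arXiv 2.6.2) and §1.2 Def. 1.2.1
(`𝓛_s(T)`); [McCallumLMS1991] §3 Prop. 3.1 (proof); [GrossLMS1991] §3 (3.3), §9;
[TateGCFT1967] §2.4 (Čebotarev); [ArtinSchreier1927Kennzeichnung] Satz 4.
-/

set_option autoImplicit false

noncomputable section

open scoped Classical Pointwise
open Function NumberField IsDedekindDomain Field

universe u

namespace Literature.NumberTheory.GaloisCohomology.Howard2004

open Literature.NumberTheory.GaloisRepresentations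
open Literature.NumberTheory.EllipticCurves

/-! ## §1 The abstract involutive lift as an element of `Γ_ℚ` -/

section Transport

variable {K : Type u} [Field K] [NumberField K]

/-- A lift `τ` of `σ ∈ Aut(K/ℚ)` to `K̄` is the transport `e c₀ e⁻¹` (tree `absGaloisTransport`,
along `e : ℚ̄ ≃ K̄`) of an element `c₀ ∈ Γ_ℚ` — namely of `e⁻¹ τ e` (Howard: «`τ ∈ Gal(ℚ̄/ℚ)`
is a fixed complex conjugation … the action of `G_K` extends to `G_ℚ = G_K ⋊ ⟨τ⟩`»).
[cite: Howard2004HeegnerKolyvagin, §1.3 Hypothesis H.5 preamble (arXiv p. 7 L33–41)] -/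
theorem exists_absGaloisTransport_eq {σ : K ≃ₐ[ℚ] K}
    {τ : AlgebraicClosure K ≃+* AlgebraicClosure K} (ht : IsLiftOfAut σ τ) :
    ∃ c₀ : absoluteGaloisGroup ℚ,
      ∀ y, absGaloisTransport (K := ℚ) (L := K) c₀ y = τ y := by
  refine ⟨(absGaloisTransport (K := ℚ) (L := K)).symm ht.algEquiv, fun y => ?_⟩
  rw [MulEquiv.apply_symm_apply]
  rfl

/-- If `τ` lifts `σ ≠ 1` and is an involution, the element `c₀ ∈ Γ_ℚ` it transports is a
non-trivial involution of `Γ_ℚ`, hence — by the Artin–Schreier theorem (tree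
`exists_isComplexConjugation_of_sq_eq_one`) and the uniqueness of `ℚ →+* ℝ` — a complex
conjugation for `ℚ ⊂ ℝ` (`IsComplexConjugation (Rat.castHom ℝ)`).
[cite: ArtinSchreier1927Kennzeichnung, Satz 4] -/
theorem isComplexConjugation_of_absGaloisTransport_eq {σ : K ≃ₐ[ℚ] K} (hσ : σ ≠ 1)
    {τ : AlgebraicClosure K ≃+* AlgebraicClosure K} (ht : IsLiftOfAut σ τ)
    (hinv : Function.Involutive τ) {c₀ : absoluteGaloisGroup ℚ}
    (hc₀ : ∀ y, absGaloisTransport (K := ℚ) (L := K) c₀ y = τ y) :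
    IsComplexConjugation (Rat.castHom ℝ) c₀ := by
  have h1 : c₀ ≠ 1 := by
    intro h
    apply hσ
    ext x
    apply (algebraMap K (AlgebraicClosure K)).injective
    rw [← ht x, ← hc₀, h, map_one, AlgEquiv.one_apply, AlgEquiv.one_apply]
  have h2 : c₀ ^ 2 = 1 := by
    apply (absGaloisTransport (K := ℚ) (L := K)).injective
    ext y
    rw [pow_two, map_mul, AlgEquiv.mul_apply, hc₀, hc₀, hinv y, map_one, AlgEquiv.one_apply]
  obtain ⟨φ, hφ⟩ := exists_isComplexConjugation_of_sq_eq_one c₀ h1 h2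
  rwa [Subsingleton.elim φ (Rat.castHom ℝ)] at hφ

/-- **«`Frob(λ') = (τσ)² = σ^τ σ`»** transported to `Γ_ℚ`: for the element `c₀ ∈ Γ_ℚ` of the
involutive lift `τ` and any `g ∈ Γ_K`, `(c₀ · res g)² = res((τ⁻¹ g τ) g)` with `res : Γ_K → Γ_ℚ`
the restriction and `τ⁻¹ g τ = IsLiftOfAut.conjGalCMH`.  (The tree's
`sq_eq_absGaloisRestrict_conjGal_mul` is the case `τ = e c₀ e⁻¹` by definition.)
[cite: McCallumLMS1991, §3 Prop. 3.1 (proof)] -/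
theorem sq_absGaloisRestrict_eq_of_absGaloisTransport_eq {σ : K ≃ₐ[ℚ] K}
    {τ : AlgebraicClosure K ≃+* AlgebraicClosure K} (ht : IsLiftOfAut σ τ)
    (hinv : Function.Involutive τ) {c₀ : absoluteGaloisGroup ℚ}
    (hc₀ : ∀ y, absGaloisTransport (K := ℚ) (L := K) c₀ y = τ y) (g : absoluteGaloisGroup K) :
    (c₀ * absGaloisRestrict ℚ K g) ^ 2 = absGaloisRestrict ℚ K (ht.conjGalCMH g * g) := by
  have hsymm : ∀ z, τ.symm z = τ z := fun z => by
    apply τ.injective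
    rw [RingEquiv.apply_symm_apply, hinv z]
  apply (absGaloisTransport (K := ℚ) (L := K)).injective
  ext y
  have h1 : ∀ z, absGaloisTransport (K := ℚ) (L := K) (c₀ * absGaloisRestrict ℚ K g) z =
      τ (g • z) := fun z ↦ by
    rw [map_mul, AlgEquiv.mul_apply, absGaloisTransport_absGaloisRestrict, hc₀]
  rw [pow_two, map_mul, AlgEquiv.mul_apply, h1, h1, absGaloisTransport_absGaloisRestrict,
    mul_smul, absoluteGaloisGroup.smul_def (ht.conjGalCMH g)]
  change _ = (show AlgebraicClosure K ≃ₐ[K] AlgebraicClosure K from ht.conjGalHom g) (g • y)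
  rw [IsLiftOfAut.conjGalHom_apply, hsymm]
  rfl

end Transport

/-! ## §2 Involutive lifts invert the roots of unity -/

section RootsOfUnity

variable {F : Type u} [Field F]

/-- **A complex conjugation inverts every root of unity**: if `c ∈ Γ_F` is a complex conjugation
for a real embedding `φ` (`ι ∘ c = conj ∘ ι` for some `ι : F̄ → ℂ` over `φ`) and `ζ^m = 1`,
`m ≠ 0`, then `c ζ = ζ⁻¹` — because `|ι ζ| = 1` forces `conj (ι ζ) = (ι ζ)⁻¹`.  (Gross 1991
(3.3): «`Frob(ℓ)` acts on `μ_p` as complex conjugation, i.e. by `ζ ↦ ζ⁻¹`».) [cite: GrossLMS1991, §3 (3.3)] -/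
theorem smul_eq_inv_of_isComplexConjugation_of_pow_eq_one {φ : F →+* ℝ}
    {c : absoluteGaloisGroup F} (hc : IsComplexConjugation φ c) {ζ : AlgebraicClosure F} {m : ℕ}
    (hm : m ≠ 0) (hζ : ζ ^ m = 1) : c • ζ = ζ⁻¹ := by
  obtain ⟨ι, -, hι⟩ := hc
  have hnorm : ‖ι ζ‖ = 1 :=
    Complex.norm_eq_one_of_pow_eq_one (by rw [← map_pow, hζ, map_one]) hm
  apply ι.injective
  rw [absoluteGaloisGroup.smul_def, hι.eq, map_inv₀, Complex.inv_eq_conj hnorm]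
  rfl

variable [NumberField F]

/-- **An involutive lift of the complex conjugation of an imaginary quadratic field inverts every
root of unity of `K̄`**: for `σ ≠ 1` in `Aut(K/ℚ)`, `τ` a ring involution of `K̄` lifting `σ`,
and `ζ ∈ K̄` with `ζ^m = 1`, `m ≠ 0`: `τ ζ = ζ⁻¹`.  (By §1 `τ = e c₀ e⁻¹` for a complex
conjugation `c₀ ∈ Γ_ℚ`; apply `smul_eq_inv_of_isComplexConjugation_of_pow_eq_one` to `e⁻¹ ζ`.)
This is the fact behind Howard's «`ℓ ∈ 𝓛_{2k-1}`», Def. 1.2.1: `Frob_ℓ = τσ` acts on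
`μ_{p^{2k-1}} ⊂ E` as `τ`, i.e. by inversion, so `p^{2k-1} ∣ ℓ + 1`.
[cite: Howard2004HeegnerKolyvagin, Def. 1.2.1 and Lemma 1.6.2 (arXiv Def. 2.2.1, Lemma 2.6.2)] -/
theorem apply_eq_inv_of_isLiftOfAut_of_pow_eq_one {σ : F ≃ₐ[ℚ] F} (hσ : σ ≠ 1)
    {τ : AlgebraicClosure F ≃+* AlgebraicClosure F} (ht : IsLiftOfAut σ τ)
    (hinv : Function.Involutive τ) {ζ : AlgebraicClosure F} {m : ℕ} (hm : m ≠ 0)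
    (hζ : ζ ^ m = 1) : τ ζ = ζ⁻¹ := by
  obtain ⟨c₀, hc₀⟩ := exists_absGaloisTransport_eq ht
  have hcc := isComplexConjugation_of_absGaloisTransport_eq hσ ht hinv hc₀
  set e := absClosureEquiv ℚ F with he
  have hζ' : (e.symm ζ) ^ m = 1 := by rw [← map_pow, hζ, map_one]
  rw [← hc₀, absGaloisTransport_apply, ← he,
    smul_eq_inv_of_isComplexConjugation_of_pow_eq_one hcc hm hζ', map_inv₀, AlgEquiv.apply_symm_apply]

end RootsOfUnity

/-! ## §3 An arithmetic Frobenius of `Γ_ℚ` on roots of unity -/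

section FrobeniusRat

/-- **`Frob_ℓ ζ = ζ^ℓ` on the roots of unity of order prime to `ℓ`**: if `γ ∈ Γ_ℚ` is an
arithmetic Frobenius at a prime `𝔓₀` of `\bar ℤ` above the place `v ∋ ℓ` of `ℚ`, then
`γ ζ = ζ^ℓ` for every `ζ ∈ ℚ̄` with `ζ^m = 1`, `ℓ ∤ m` (Mathlib
`AlgHom.IsArithFrobAt.apply_of_pow_eq_one` on `\bar ℤ`, where `ζ` lives, with
`#(ℤ/v) = ℓ`).  Gross 1991 (3.3): «`Frob(ℓ)` acts on `μ_p` by `ζ ↦ ζ^ℓ`».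
[cite: GrossLMS1991, §3 (3.3)] -/
theorem smul_eq_pow_of_isArithFrobAt_rat {ℓ : ℕ} (hℓ : ℓ.Prime) {v : HeightOneSpectrum (𝓞 ℚ)}
    (hℓv : (ℓ : 𝓞 ℚ) ∈ v.asIdeal) {𝔓₀ : Ideal (absIntegers (𝓞 ℚ) ℚ)} (h𝔓₀ : 𝔓₀ ∈ v.primesAbove)
    {γ : absoluteGaloisGroup ℚ} (hγ : IsArithFrobAt (𝓞 ℚ) γ 𝔓₀) {m : ℕ} (hℓm : ¬ ℓ ∣ m)
    {ζ : AlgebraicClosure ℚ} (hζ : ζ ^ m = 1) : γ • ζ = ζ ^ ℓ := by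
  have hm : m ≠ 0 := by rintro rfl; exact hℓm (dvd_zero ℓ)
  -- `ζ ∈ \bar ℤ`
  have hintZ : IsIntegral ℤ ζ :=
    IsIntegral.of_pow (Nat.pos_of_ne_zero hm) (by rw [hζ]; exact isIntegral_one)
  have hint : IsIntegral (𝓞 ℚ) ζ := hintZ.tower_top
  set z : absIntegers (𝓞 ℚ) ℚ := ⟨ζ, hint⟩ with hz
  have hzm : z ^ m = 1 := Subtype.ext (by rw [SubmonoidClass.coe_pow, OneMemClass.coe_one]; exact hζ)
  -- `m ∉ 𝔓₀`: `v = (ℓ)` and `ℓ ∤ m`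
  have hmv : (m : 𝓞 ℚ) ∉ v.asIdeal := by
    intro hmem
    rw [← span_natCast_rat_eq hℓ hℓv, Ideal.mem_span_singleton] at hmem
    apply hℓm
    have h := map_dvd (Rat.ringOfIntegersEquiv : 𝓞 ℚ →+* ℤ) hmem
    rw [map_natCast, map_natCast] at h
    exact Int.natCast_dvd_natCast.mp h
  have hm𝔓 : (m : absIntegers (𝓞 ℚ) ℚ) ∉ 𝔓₀ := absIntegers.natCast_notMem_of_mem_primesAbove hmv h𝔓₀
  -- `#(ℤ/v) = ℓ`
  have hq : Nat.card (𝓞 ℚ ⧸ 𝔓₀.under (𝓞 ℚ)) = ℓ := by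
    rw [HeightOneSpectrum.card_quotient_under_eq_residueCard h𝔓₀, HeightOneSpectrum.residueCard,
      ← span_natCast_rat_eq hℓ hℓv, Ideal.absNorm_span_singleton,
      show (ℓ : 𝓞 ℚ) = algebraMap ℤ (𝓞 ℚ) (ℓ : ℤ) by simp, Algebra.norm_algebraMap,
      NumberField.RingOfIntegers.rank, Module.finrank_self, pow_one, Int.natAbs_natCast]
  have h := hγ.apply_of_pow_eq_one hzm hm𝔓
  rw [MulSemiringAction.toAlgHom_apply, hq] at h
  have h' := congrArg (fun t : absIntegers (𝓞 ℚ) ℚ ↦ (t : AlgebraicClosure ℚ)) h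
  simpa [integralClosure.coe_smul] using h'

end FrobeniusRat

/-! ## §4 The Čebotarev step of Lemma 1.6.2 -/

section Main

variable {K : Type u} [Field K] [NumberField K]

/-- **Howard 2004, Lemma 1.6.2 — the Čebotarev step (module-free, abstract involutive lift).**
Let `K` be imaginary quadratic, `σ ≠ 1` its non-trivial automorphism and `τ` ANY ring involution
of `K̄` lifting `σ` (the `τ` of a `ConjugationDatum`).  For every open subgroup `U ≤ Γ_K` (Howard:
`Γ_E`, `E/ℚ` finite Galois), every `g ∈ Γ_K` (Howard: `σ ∈ G = Gal(E/L)`), every finite set `B`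
of rational primes and every finite set `S` of finite places of `K`, there are a prime `ℓ ∉ B`
with `(ℓ) = ℓ 𝓞_K` prime (so `ℓ` is INERT, `λ = (ℓ)` of degree two), its place `w ∉ S`
(the unique place above `ℓ`), an element `u ∈ U` and a prime `𝔔 ∣ w` of `\bar ℤ_K` such that
**`(ug)^τ (ug) = τ⁻¹(ug)τ · (ug)` is an arithmetic Frobenius at `𝔔`** («`Frob(λ') = (τσ)² =
σ^τ σ`» — `Frob_ℓ = τ·(ug)` in `Gal(K̄/ℚ)`), and **`τ((ug) ζ) = ζ^ℓ` for every root of unity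
`ζ ∈ K̄` of order `m` prime to `ℓ`** («`Frob_ℓ = τσ` on `μ_m`»); consequently `m ∣ ℓ + 1` as soon
as `ug` fixes `μ_m` (Howard: `E ⊇ K(μ_{p^{2k-1}})`, so `p^{2k-1} ∣ ℓ + 1` and `ℓ ∈ 𝓛_{2k-1}`).
Printed: «By the Cebotarev theorem, there are infinitely many primes `ℓ` of `ℚ` whose Frobenius
class in `Gal(E/ℚ)` is equal to `τσ` … evaluation at the Frobenius of the prime of `K` above `ℓ`».
Proof = McCallum's Steps C–F as in the tree's `exists_kolyvaginPrime_gt_of_galoisElement`: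
Frobenius elements of `Γ_ℚ` outside a finite set are dense (`absoluteGaloisGroup.frobenius_dense`,
from Čebotarev), so one lies in the open set `c₀ · res(U g)` (`c₀` = §1's element of `τ`);
it is not a restriction from the totally complex `K`, so its place is inert with Frobenius its
square over `K` (`exists_place_inert_of_not_mem_range`), which is `res((ug)^τ(ug))` (§1); §3 and
§2 give the cyclotomic clauses.
[cite: Howard2004HeegnerKolyvagin, Lemma 1.6.2 (arXiv:1202.6340 Lemma 2.6.2, p. 11 L48–58)]
[cite: McCallumLMS1991, §3 Prop. 3.1 (proof)] -/
theorem exists_inert_prime_isArithFrobAt_conjGal_mul (hC : Automorphic.chebotarev_artinRep)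
    (hK : IsImaginaryQuadratic K) {σ : K ≃ₐ[ℚ] K} (hσ : σ ≠ 1)
    {τ : AlgebraicClosure K ≃+* AlgebraicClosure K} (ht : IsLiftOfAut σ τ)
    (hinv : Function.Involutive τ) {U : Subgroup (absoluteGaloisGroup K)}
    (hU : IsOpen (U : Set (absoluteGaloisGroup K))) (g : absoluteGaloisGroup K) (B : Finset ℕ)
    {S : Set (HeightOneSpectrum (𝓞 K))} (hS : S.Finite) :
    ∃ ℓ : ℕ, ℓ.Prime ∧ ℓ ∉ B ∧ (Ideal.span {(ℓ : 𝓞 K)}).IsPrime ∧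
      ∃ w : HeightOneSpectrum (𝓞 K), w ∉ S ∧ (ℓ : 𝓞 K) ∈ w.asIdeal ∧
        (∀ w' : HeightOneSpectrum (𝓞 K), (ℓ : 𝓞 K) ∈ w'.asIdeal → w' = w) ∧
        ∃ u ∈ U, (∃ 𝔔 ∈ w.primesAbove, IsArithFrobAt (𝓞 K) (ht.conjGalCMH (u * g) * (u * g)) 𝔔) ∧
          (∀ (m : ℕ) (ζ : AlgebraicClosure K), ¬ ℓ ∣ m → ζ ^ m = 1 →
            τ ((u * g) • ζ) = ζ ^ ℓ) ∧
          ∀ m : ℕ, ¬ ℓ ∣ m → (∀ ζ : AlgebraicClosure K, ζ ^ m = 1 → (u * g) • ζ = ζ) →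
            m ∣ ℓ + 1 := by
  classical
  haveI : Algebra.IsQuadraticExtension ℚ K := ⟨hK.1⟩
  haveI : IsTotallyComplex K := hK.2
  obtain ⟨c₀, hc₀⟩ := exists_absGaloisTransport_eq ht
  have hcc : IsComplexConjugation (Rat.castHom ℝ) c₀ :=
    isComplexConjugation_of_absGaloisTransport_eq hσ ht hinv hc₀
  -- ### Step C: the finite exceptional set of places of `ℚ`
  set S₁ : Set (HeightOneSpectrum (𝓞 ℚ)) := {v | ∃ q ∈ B, q.Prime ∧ (q : 𝓞 ℚ) ∈ v.asIdeal}
    with hS₁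
  set S₂ : Set (HeightOneSpectrum (𝓞 ℚ)) := {v | ¬ Algebra.IsUnramifiedIn (𝓞 K) v.asIdeal}
    with hS₂
  set S₃ : Set (HeightOneSpectrum (𝓞 ℚ)) :=
    (fun w : HeightOneSpectrum (𝓞 K) ↦ w.under (𝓞 ℚ)) '' S with hS₃
  have hS₁fin : S₁.Finite := by
    have : S₁ ⊆ ⋃ q ∈ (B.filter Nat.Prime), {v | (q : 𝓞 ℚ) ∈ v.asIdeal} := by
      intro v ⟨q, hqB, hq, hqv⟩
      simp only [Set.mem_iUnion, Finset.mem_filter]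
      exact ⟨q, ⟨hqB, hq⟩, hqv⟩
    refine Set.Finite.subset (Set.Finite.biUnion (Finset.finite_toSet _) fun q hq ↦ ?_) this
    rw [Finset.coe_filter, Set.mem_setOf_eq] at hq
    have hsub : {v : HeightOneSpectrum (𝓞 ℚ) | (q : 𝓞 ℚ) ∈ v.asIdeal}.Subsingleton :=
      fun v hv v' hv' ↦ HeightOneSpectrum.eq_of_natCast_mem_rat hq.2 hv hv'
    exact hsub.finite
  have hS₂fin : S₂.Finite := finite_setOf_not_isUnramifiedIn ℚ K
  have hS₃fin : S₃.Finite := hS.image _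
  set T := S₁ ∪ S₂ ∪ S₃ with hTdef
  have hTfin : T.Finite := (hS₁fin.union hS₂fin).union hS₃fin
  -- ### Step D: Čebotarev in `Γ_ℚ`: a Frobenius in the open set `c₀ · res(U g)`
  obtain ⟨O, hO⟩ : ∃ O : Set (absoluteGaloisGroup ℚ), O = (fun γ ↦ c₀ * γ) ''
      (absGaloisRestrict ℚ K '' ((fun u ↦ u * g) '' (U : Set (absoluteGaloisGroup K)))) :=
    ⟨_, rfl⟩
  have hOopen : IsOpen O := by
    rw [hO]
    refine (Homeomorph.mulLeft c₀).isOpenMap _ (isOpenMap_absGaloisRestrict K _ ?_)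
    exact (Homeomorph.mulRight g).isOpenMap _ hU
  have hOne : O.Nonempty :=
    ⟨c₀ * absGaloisRestrict ℚ K (1 * g), hO ▸ ⟨_, ⟨_, ⟨1, U.one_mem, rfl⟩, rfl⟩, rfl⟩⟩
  obtain ⟨γ, hγO, v, hvT, 𝔓₀, h𝔓₀, hγ⟩ :=
    (absoluteGaloisGroup.frobenius_dense hC ℚ T hTfin).inter_open_nonempty O hOopen hOne
  rw [hO] at hγO
  obtain ⟨_, ⟨_, ⟨u, hu, rfl⟩, rfl⟩, rfl⟩ := hγO
  set h := u * g with hh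
  -- ### Step E: the rational prime `ℓ` under `v`
  obtain ⟨ℓ, hℓ, hℓv⟩ := exists_prime_natCast_mem v
  have hℓB : ℓ ∉ B := fun hB ↦ hvT (Or.inl (Or.inl ⟨ℓ, hB, hℓ, hℓv⟩))
  have hunr : Algebra.IsUnramifiedIn (𝓞 K) v.asIdeal := by
    by_contra hn; exact hvT (Or.inl (Or.inr hn))
  have hvS₃ : v ∉ S₃ := fun hv ↦ hvT (Or.inr hv)
  -- ### Step F: `ℓ` is inert, with a Frobenius `h^τ h` over `K`
  have hHi := index_range_absGaloisRestrict_eq_finrank ℚ K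
  haveI hHn : ((absGaloisRestrict ℚ K).range).Normal :=
    Subgroup.normal_of_index_eq_two (hHi.trans hK.1)
  have hI := inertia_le_range_absGaloisRestrict_of_isUnramifiedIn (K := K) hunr h𝔓₀
  have hΦH : c₀ * absGaloisRestrict ℚ K h ∉ (absGaloisRestrict ℚ K).range := by
    intro hmem
    apply hcc.not_mem_range_absGaloisRestrict (L := K) IsTotallyComplex.isComplex
    change c₀ ∈ ((absGaloisRestrict ℚ K).range : Set (absoluteGaloisGroup ℚ))
    have h' : c₀ = c₀ * absGaloisRestrict ℚ K h * (absGaloisRestrict ℚ K h)⁻¹ := by group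
    rw [SetLike.mem_coe, h']
    exact Subgroup.mul_mem _ hmem (Subgroup.inv_mem _ ⟨h, rfl⟩)
  obtain ⟨w, 𝔔, τ', hwv, hwuniq, -, h𝔔w, -, hτ', hresτ'⟩ :=
    exists_place_inert_of_not_mem_range (F := ℚ) (M := K) (hK.1 ▸ Nat.prime_two) hHn
      (hHi.trans rfl) hunr h𝔓₀ hI hγ hΦH
  rw [hK.1, sq_absGaloisRestrict_eq_of_absGaloisTransport_eq ht hinv hc₀ h] at hresτ'
  have hτ'eq : τ' = ht.conjGalCMH h * h := absGaloisRestrict_injective ℚ K hresτ'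
  -- `ℓ ∈ w`, and `w` is the only place of `K` containing `ℓ`
  have hℓw : (ℓ : 𝓞 K) ∈ w.asIdeal := by
    have h1 : (ℓ : 𝓞 ℚ) ∈ (w.under (𝓞 ℚ)).asIdeal := by rw [hwv]; exact hℓv
    rw [HeightOneSpectrum.under_asIdeal, Ideal.under_def, Ideal.mem_comap, map_natCast] at h1
    exact h1
  have hwuniq' : ∀ w' : HeightOneSpectrum (𝓞 K), (ℓ : 𝓞 K) ∈ w'.asIdeal → w' = w := by
    intro w' hw'
    apply hwuniq
    apply HeightOneSpectrum.eq_of_natCast_mem_rat hℓ _ hℓv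
    rw [HeightOneSpectrum.under_asIdeal, Ideal.under_def, Ideal.mem_comap, map_natCast]
    exact hw'
  -- `(ℓ) = w` is prime
  have hspan : Ideal.span {(ℓ : 𝓞 K)} = w.asIdeal := by
    apply span_natCast_eq_of_unique hℓ w hwuniq'
    haveI : w.asIdeal.LiesOver v.asIdeal := ⟨by rw [← hwv]; rfl⟩
    have hmap : v.asIdeal.map (algebraMap (𝓞 ℚ) (𝓞 K)) = Ideal.span {(ℓ : 𝓞 K)} := by
      rw [← span_natCast_rat_eq hℓ hℓv, Ideal.map_span, Set.image_singleton, map_natCast]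
    have hne : v.asIdeal.map (algebraMap (𝓞 ℚ) (𝓞 K)) ≠ ⊥ := by
      rw [hmap, Ne, Ideal.span_singleton_eq_bot]; exact_mod_cast hℓ.ne_zero
    rw [← hmap, ← Ideal.IsDedekindDomain.ramificationIdx_eq_normalizedFactors_count v.asIdeal
      w.asIdeal hne]
    exact Ideal.ramificationIdx_eq_one_iff.mpr (hunr w.asIdeal w.isPrime inferInstance)
  -- `w ∉ S`
  have hwS : w ∉ S := fun hw ↦ hvS₃ ⟨w, hw, hwv⟩
  -- ### the cyclotomic clauses
  have hcyc : ∀ (m : ℕ) (ζ : AlgebraicClosure K), ¬ ℓ ∣ m → ζ ^ m = 1 → τ (h • ζ) = ζ ^ ℓ := by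
    intro m ζ hℓm hζ
    set e := absClosureEquiv ℚ K with he
    have hζ' : (e.symm ζ) ^ m = 1 := by rw [← map_pow, hζ, map_one]
    have hfrob := smul_eq_pow_of_isArithFrobAt_rat hℓ hℓv h𝔓₀ hγ hℓm hζ'
    have h1 : τ (h • ζ) = absGaloisTransport (K := ℚ) (L := K) (c₀ * absGaloisRestrict ℚ K h) ζ := by
      rw [map_mul, AlgEquiv.mul_apply, absGaloisTransport_absGaloisRestrict, hc₀]
    rw [h1, absGaloisTransport_apply, ← he, hfrob, map_pow, AlgEquiv.apply_symm_apply]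
  refine ⟨ℓ, hℓ, hℓB, hspan ▸ w.isPrime, w, hwS, hℓw, hwuniq', u, hu, ⟨𝔔, h𝔔w, hτ'eq ▸ hτ'⟩,
    hcyc, fun m hℓm hfix ↦ ?_⟩
  -- `m ∣ ℓ + 1` when `h` fixes `μ_m`: `τ ζ = ζ^ℓ` (above) and `τ ζ = ζ⁻¹` (§2)
  have hm : m ≠ 0 := by rintro rfl; exact hℓm (dvd_zero ℓ)
  haveI : NeZero m := ⟨hm⟩
  haveI : NeZero (m : AlgebraicClosure K) := NeZero.charZero
  obtain ⟨ζ, hζ⟩ := HasEnoughRootsOfUnity.exists_primitiveRoot (AlgebraicClosure K) m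
  have h1 := hcyc m ζ hℓm hζ.pow_eq_one
  rw [hfix ζ hζ.pow_eq_one, apply_eq_inv_of_isLiftOfAut_of_pow_eq_one hσ ht hinv hm hζ.pow_eq_one]
    at h1
  apply hζ.dvd_of_pow_eq_one
  rw [pow_succ, ← h1, inv_mul_cancel₀ (hζ.ne_zero hm)]

end Main

end Literature.NumberTheory.GaloisCohomology.Howard2004

end
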